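import Summits.Ventures.Crystal3D.Theorems.StickyWulffConstantNoReconstructionGainPredSlotBudgetPairs
import HarnessLib

/-!
# The pred-slot budget with a raised up bond, three contacts: the two symmetric special normals

HONEST FRAMING. Part of the venture `Summits/Ventures/Crystal3D` (cell `crystal3d-full`), helper
`--supports` the crux `NoReconstructionGain` (stmt-Ventures-19144, route
`route-Ventures-StickyWulffConstant`), line `adhesion` (wulff-p1 g14).  Pure real-variable bricks for
the remaining piece B1b₃ (`predSlotBudget_of_upBond_raised_three`, skeleton v21) of the g13 brick
`stub_predSlotBudget70`, memo RAISED-g14.md §4: after the landed-budget reduction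
(`…PredSlotBudgetRaisedLanded`) and integrality, the two normals with MORE THAN ONE level pair need a
direct count (cubic coordinates of `…GrainFrameBudgetThree`, contacts `x² + y² + z² = 2`, pairwise
`x x' + y y' + z z' ≤ 1`):
* `cubicAxis_three_steep` — `n = (0,0,√2)` (the grain shows a cube face; `H₁` and `W₃` level): two
  contacts of cubic height `> 1` block at least three of the four steep slots `(±1,0,1)`, `(0,±1,1)`.
* `twin_all_three` — the twin point `n ∝ (1,1,1)` (`H₃`, `W₂`, `W₃` level): three contacts with
  `x + y + z > 2` block all three deep slots `(1,1,0)`, `(1,0,1)`, `(0,1,1)` (each blocks two; three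
  pairwise `≥ 60°` apart cannot all miss the same one — half-plane/obtuse lemma via
  `not_three_neg_products`).

WHAT THIS IS NOT: the generic raised frame with three contacts; rung F-C1 not moved.
-/

namespace Summit.Ventures.Crystal3D.Theorems

/-- **Cube-face normal.**  Two contacts of cubic height `> 1` at mutual inner product `≤ 1` block at least
three of the four steep slots. -/
theorem cubicAxis_three_steep {x₁ y₁ z₁ x₂ y₂ z₂ : ℝ} (hz₁ : 1 < z₁) (hz₂ : 1 < z₂)
    (h12 : x₁ * x₂ + y₁ * y₂ + z₁ * z₂ ≤ 1) :
    (3 : ℝ) ≤ (if (1 < x₁ + z₁ ∨ 1 < x₂ + z₂) then (1 : ℝ) else 0) + (if (1 < z₁ - x₁ ∨ 1 < z₂ - x₂) then (1 : ℝ) else 0) +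
      (if (1 < y₁ + z₁ ∨ 1 < y₂ + z₂) then (1 : ℝ) else 0) + (if (1 < z₁ - y₁ ∨ 1 < z₂ - y₂) then (1 : ℝ) else 0) := by
  have hxy : x₁ * x₂ + y₁ * y₂ < 0 := by nlinarith [mul_pos (sub_pos.2 hz₁) (sub_pos.2 hz₂)]
  -- each contact blocks one of `B₂/W₂` (sign of `x`) and one of `W₁/B₃` (sign of `y`)
  by_cases p : 1 < x₁ + z₁ ∨ 1 < x₂ + z₂ <;> by_cases m : 1 < z₁ - x₁ ∨ 1 < z₂ - x₂ <;>
    by_cases q : 1 < y₁ + z₁ ∨ 1 < y₂ + z₂ <;> by_cases r : 1 < z₁ - y₁ ∨ 1 < z₂ - y₂ <;>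
    simp only [p, m, q, r, if_true, if_false] <;> norm_num
  all_goals
    push Not at *
    first
    | (obtain ⟨p1, p2⟩ := p; obtain ⟨m1, m2⟩ := m; linarith)
    | (obtain ⟨q1, q2⟩ := q; obtain ⟨r1, r2⟩ := r; linarith)
    | (obtain ⟨m1, m2⟩ := m; obtain ⟨r1, r2⟩ := r
       nlinarith [mul_pos (by linarith : 0 < x₁) (by linarith : 0 < x₂),
         mul_pos (by linarith : 0 < y₁) (by linarith : 0 < y₂)])
    | (obtain ⟨m1, m2⟩ := m; obtain ⟨q1, q2⟩ := q
       nlinarith [mul_pos (by linarith : 0 < x₁) (by linarith : 0 < x₂),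
         mul_pos_of_neg_of_neg (by linarith : y₁ < 0) (by linarith : y₂ < 0)])
    | (obtain ⟨p1, p2⟩ := p; obtain ⟨r1, r2⟩ := r
       nlinarith [mul_pos_of_neg_of_neg (by linarith : x₁ < 0) (by linarith : x₂ < 0),
         mul_pos (by linarith : 0 < y₁) (by linarith : 0 < y₂)])
    | (obtain ⟨p1, p2⟩ := p; obtain ⟨q1, q2⟩ := q
       nlinarith [mul_pos_of_neg_of_neg (by linarith : x₁ < 0) (by linarith : x₂ < 0),
         mul_pos_of_neg_of_neg (by linarith : y₁ < 0) (by linarith : y₂ < 0)])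

/-- **Twin point, one deep slot.**  Three contacts with `x + y + z > 2`, pairwise inner products `≤ 1`,
cannot all have `x + y ≤ 1`: their `(x, y)` parts would lie in the open half-plane `x + y > 0` with
pairwise negative inner products. -/
theorem twin_slot_blocked {x₁ y₁ z₁ x₂ y₂ z₂ x₃ y₃ z₃ : ℝ}
    (hu₁ : x₁ ^ 2 + y₁ ^ 2 + z₁ ^ 2 = 2) (hu₂ : x₂ ^ 2 + y₂ ^ 2 + z₂ ^ 2 = 2)
    (hu₃ : x₃ ^ 2 + y₃ ^ 2 + z₃ ^ 2 = 2)
    (hs₁ : 2 < x₁ + y₁ + z₁) (hs₂ : 2 < x₂ + y₂ + z₂) (hs₃ : 2 < x₃ + y₃ + z₃)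
    (h12 : x₁ * x₂ + y₁ * y₂ + z₁ * z₂ ≤ 1) (h13 : x₁ * x₃ + y₁ * y₃ + z₁ * z₃ ≤ 1)
    (h23 : x₂ * x₃ + y₂ * y₃ + z₂ * z₃ ≤ 1) :
    1 < x₁ + y₁ ∨ 1 < x₂ + y₂ ∨ 1 < x₃ + y₃ := by
  by_contra h
  push Not at h
  obtain ⟨h1, h2, h3⟩ := h
  have hz₁ : 1 < z₁ := by linarith
  have hz₂ : 1 < z₂ := by linarith
  have hz₃ : 1 < z₃ := by linarith
  -- `z ≤ √2 < 3/2`, so `x + y > 1/2 > 0`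
  have hzb₁ : z₁ < 3 / 2 := by nlinarith
  have hzb₂ : z₂ < 3 / 2 := by nlinarith
  have hzb₃ : z₃ < 3 / 2 := by nlinarith
  have q1 : 0 < x₁ + y₁ := by linarith
  have q2 : 0 < x₂ + y₂ := by linarith
  have q3 : 0 < x₃ + y₃ := by linarith
  have d12 : x₁ * x₂ + y₁ * y₂ < 0 := by nlinarith [mul_pos (sub_pos.2 hz₁) (sub_pos.2 hz₂)]
  have d13 : x₁ * x₃ + y₁ * y₃ < 0 := by nlinarith [mul_pos (sub_pos.2 hz₁) (sub_pos.2 hz₃)]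
  have d23 : x₂ * x₃ + y₂ * y₃ < 0 := by nlinarith [mul_pos (sub_pos.2 hz₂) (sub_pos.2 hz₃)]
  -- Lagrange identity with `r = (1,1)`: `2 ⟪v, w⟫ = (r·v)(r·w) + (r×v)(r×w)`
  have L : ∀ X Y X' Y' : ℝ, 2 * (X * X' + Y * Y') = (X + Y) * (X' + Y') + (Y - X) * (Y' - X') := by
    intro X Y X' Y'; ring
  have p12 : (y₁ - x₁) * (y₂ - x₂) < 0 := by
    have := L x₁ y₁ x₂ y₂; nlinarith [mul_pos q1 q2]
  have p13 : (y₁ - x₁) * (y₃ - x₃) < 0 := by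
    have := L x₁ y₁ x₃ y₃; nlinarith [mul_pos q1 q3]
  have p23 : (y₂ - x₂) * (y₃ - x₃) < 0 := by
    have := L x₂ y₂ x₃ y₃; nlinarith [mul_pos q2 q3]
  exact not_three_neg_products p12 p13 p23

/-- **Twin point.**  Three contacts with `x + y + z > 2` and pairwise inner products `≤ 1` block all three
deep slots `(1,1,0)`, `(1,0,1)`, `(0,1,1)`. -/
theorem twin_all_three {x₁ y₁ z₁ x₂ y₂ z₂ x₃ y₃ z₃ : ℝ}
    (hu₁ : x₁ ^ 2 + y₁ ^ 2 + z₁ ^ 2 = 2) (hu₂ : x₂ ^ 2 + y₂ ^ 2 + z₂ ^ 2 = 2)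
    (hu₃ : x₃ ^ 2 + y₃ ^ 2 + z₃ ^ 2 = 2)
    (hs₁ : 2 < x₁ + y₁ + z₁) (hs₂ : 2 < x₂ + y₂ + z₂) (hs₃ : 2 < x₃ + y₃ + z₃)
    (h12 : x₁ * x₂ + y₁ * y₂ + z₁ * z₂ ≤ 1) (h13 : x₁ * x₃ + y₁ * y₃ + z₁ * z₃ ≤ 1)
    (h23 : x₂ * x₃ + y₂ * y₃ + z₂ * z₃ ≤ 1) :
    (1 < x₁ + y₁ ∨ 1 < x₂ + y₂ ∨ 1 < x₃ + y₃) ∧ (1 < x₁ + z₁ ∨ 1 < x₂ + z₂ ∨ 1 < x₃ + z₃) ∧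
      (1 < y₁ + z₁ ∨ 1 < y₂ + z₂ ∨ 1 < y₃ + z₃) := by
  refine ⟨twin_slot_blocked hu₁ hu₂ hu₃ hs₁ hs₂ hs₃ h12 h13 h23, ?_, ?_⟩
  · exact twin_slot_blocked (x₁ := x₁) (y₁ := z₁) (z₁ := y₁) (x₂ := x₂) (y₂ := z₂) (z₂ := y₂)
      (x₃ := x₃) (y₃ := z₃) (z₃ := y₃) (by linarith) (by linarith) (by linarith) (by linarith)
      (by linarith) (by linarith) (by linarith) (by linarith) (by linarith)
  · exact twin_slot_blocked (x₁ := y₁) (y₁ := z₁) (z₁ := x₁) (x₂ := y₂) (y₂ := z₂) (z₂ := x₂)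
      (x₃ := y₃) (y₃ := z₃) (z₃ := x₃) (by linarith) (by linarith) (by linarith) (by linarith)
      (by linarith) (by linarith) (by linarith) (by linarith) (by linarith)

end Summit.Ventures.Crystal3D.Theorems
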